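import Literature.NumberTheory.LFunctions.Zhang2022.RepairBlenMuNu
import Literature.NumberTheory.LFunctions.Zhang2022.Section4Prop22Eventually
import HarnessLib

/-!
# Zhang (2022), programme F-S3 §E (cell landau-siegel, barrier extension): the B-len endgames with the manuscript's
# Part-I nodes DISCHARGED — sibling LEAF of `KnifeEdgeEndgameClosed` (p476246) for the modules of the B-len typer-1
# lineage: E-002 (`KnifeEdgeOffDiagForm`), E-070/E-071 (`KnifeEdgeLambdaOverhang`, the dictionaries behind REF-E E-15 and
# row 39), E-17 (`RepairBlenMuNu`, the νψ family whose VERDICT displays `Prop22i`/`Lemma23 c′`). Nothing imports this file.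

Y. Zhang, *Discrete mean estimates and the Landau–Siegel zero*, arXiv:2211.02515v1 [Zhang2022LandauSiegel] — an
unrefereed manuscript under adjudication. **WHAT THIS IS NOT: not a claim about Theorems 1–2 of arXiv:2211.02515,
about Landau–Siegel zeros, about a repaired `Margin232`, or about Parity. Every ANALYTIC input below (the
dictionaries `EStarLenPlusShape` / `EStarLenPlusBounded`, `ELambdaOverhang`, `ELambdaOverhangGraded`, the slot
`NuMeanInvisible`, a `HasMainConstant` row) stays DISPLAYED, never asserted; what is removed from the displays is only
what the tree PROVES. The programme SEARCHES and TYPES; no claim about Landau–Siegel zeros, Theorems 1–2 of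
arXiv:2211.02515 or a repaired Margin232 until a kernel theorem says so.**

## The point (BARRIER-STATE §2′ N12; same as `KnifeEdgeEndgameClosed`, p476246, ls-Bmulti-typer-1 g3)

The positivity endgames of the B-len typer-1 modules display the manuscript's Proposition 2.2 (i)
(`Skeleton.Prop22i`) and Lemma 2.3 (`Skeleton.Lemma23 c′`) as hypotheses «CLAIMS of the manuscript, never asserted».
Both are KERNEL THEOREMS of the tree in the threshold reading (`Skeleton.prop22i_holds : Prop22i`, no hypothesis;
`Skeleton.lemma23_eventually : ∃ c₀ ≥ 0, ∀ c′ ≥ c₀, Lemma23 c′`, module `Section4Prop22Eventually`, p439781; F-S1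
adjudication errata E22). The constant `c′` is the manuscript's free «some (large) constant `c′ > 0`» of (2.13)
(p. 7), a parameter of every dictionary row below; hence each endgame has a CLOSED twin
`∃ c₀ ≥ 0, ∀ c′ ≥ c₀, ⟨dictionary at c′⟩ → ⟨closing⟩ → Theorem1 ∧ Theorem2` (resp. `→ ¬(A) eventually`, resp. the
family verdict) with NO manuscript claim displayed. `KnifeEdgeEndgameClosed` recorded these twins for the root
endgames and for E*-len, E-034/E-10, E-14, E-16/E-17 (dictionary form `MuPsiDict`/`NuDict`), E-19; this sibling records
them for the endgames it does not reach (it does not import the B-len typer-1 modules):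

* Part 1 — **E-002** (`KnifeEdgeOffDiagForm`, p458017): `theorem1_of_eStarLenPlusShape_closed`,
  `theorem1_of_eStarLenPlusBounded_closed` (E*-len⁺ for a class `𝒱` in the `X`-world / priced at level `C` + a
  closing design ⇒ Theorems 1 and 2).
* Part 2 — **E-070/E-071** (`KnifeEdgeLambdaOverhang`, p461166 + p462691; the dictionaries behind the §E rows 25–26
  `familyLambdaOverhangAll` / `familyLambdaGradedAll` (REF-E E-15) and row 39 `familyLambdaWholeAll`):
  `theorem1_of_eLambdaOverhang_closed`, `theorem1_of_eLambdaOverhang_indefinite_closed` (edge-report route),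
  `eventually_not_assumptionA_of_le_closed` (the graded positivity endgame), `theorem1_of_eLambdaOverhangGraded_closed`,
  `theorem1_of_eLambdaOverhangGraded_aZero_closed`.
* Part 3 — **E-17** (`RepairBlenMuNu`, p469249 + p473090): the νψ family VERDICT with `Prop22i`/`Lemma23 c′` discharged
  — `familyNuOverhang_verdict_closed` (per world), `familyNuOverhangAll_verdict_closed` (all worlds `c′ ≥ c₀`),
  `not_repairable_nuOverhang_closed`, `familyNuOverhangAll_record_not_closes_closed`; and the (c)-door
  `theorem1_of_negative_mainConstant_closed`. After this discharge the ONLY displayed inputs of the E-17 verdict are the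
  analytic slot `NuMeanInvisible c′ θ (bvOverhang θ) S` (E-074′, «CONDITIONAL» flag of record) and the manuscript's
  `ScaleEventuallyPos S` for the chosen scale.

Not touched: the E-15 / row-39 VERDICTS (`familyLambdaOverhangAll_decided`, `familyLambdaWholeAll_decided`) display no
Part-I node (their displayed inputs are the slots E-070/E-071 only), so they need no twin; E-16's `MuPsiDict` form is in
`KnifeEdgeEndgameClosed`; E-20 (`RepairBlenNuLipschitz`, ls-Blen-typer-2) also displays `Prop71 c′` — ITSELF A TREE
THEOREM (`Section7cStatements.prop71X_holds : ∀ c′, Skeleton.Prop71 c′`, module `Section7Prop71Holds`, standard axioms;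
its last leaf (7.11) is closed on the full (7.2) support by `eq711X'_holds`, p436190) — so its closed twin displays NO
manuscript node at all; that twin is its owner's leaf (`RepairBlenNuLipschitzClosed`, ls-Blen-typer-2 g3).  ERRATUM
(v2, docstring only, 2026-08-27): v1 of this docstring repeated the sentence «`Prop71 c′` … is NOT discharged (its tree
closure runs through the leaf (7.11))» from `KnifeEdgeEndgameClosed`'s module docstring; that sentence is STALE —
checked by `example (c' : ℝ) : Skeleton.Prop71 c' := Section7cStatements.prop71X_holds c'` (farm rc 0) — and is
withdrawn here; no theorem of this file used it.  Theorems only (compositions of landed theorems); no definition, no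
new named fact; standard axioms; no class / row / verdict of `Repair.Rplusplus<k>` changes.

References: Zhang, arXiv:2211.02515v1, §1 Theorems 1–2, §2 pp. 4–7 (Prop. 2.2, Lemma 2.3, (2.13), (2.15)–(2.16)),
§7 Prop 7.1 (7.2) [cite: Zhang2022LandauSiegel, §2 Prop. 2.2; §2 Lemma 2.3; §7 Prop 7.1].
-/

noncomputable section

open Complex Real Set

namespace Literature.NumberTheory.LFunctions.Zhang2022

namespace KnifeEdge

open Repair Skeleton

/-! ### Part 1 — E-002 (`KnifeEdgeOffDiagForm`): the two-piece class endgames, CLOSED -/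

section EStarLenPlusClosed

/-- **E-002 in the `X`-world, closed:** for every sufficiently large `c′`, E*-len⁺ of shape `X` for the class `𝒱` at
`c′` + a design of the class with NEGATIVE two-piece constant ⇒ Theorems 1 AND 2 of the manuscript — the dictionary
and its closing are the only displayed inputs (`theorem1_of_eStarLenPlusShape`, p458017, with `Prop22i`/`Lemma23`
discharged by `prop22i_holds` / `lemma23_eventually`). [cite: Zhang2022LandauSiegel, §1 Theorems 1–2; §2 p. 6, Lemma 2.3, Prop. 2.2 (i); §7 Prop 7.1 (7.2)] -/
theorem theorem1_of_eStarLenPlusShape_closed :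
    ∃ c₀ : ℝ, 0 ≤ c₀ ∧ ∀ c' : ℝ, c₀ ≤ c' → ∀ {θ : ℝ} {X : PairFunctional} {𝒱 : (ℝ → ℂ) → (ℝ → ℂ) → Prop},
      EStarLenPlusShape c' θ X 𝒱 → ClosesByPositivityIn θ X 𝒱 → Theorem1 ∧ Theorem2 := by
  obtain ⟨c₀, h0, h⟩ := lemma23_eventually
  exact ⟨c₀, h0, fun c' hc' _ _ _ hE hC =>
    ⟨theorem1_of_eStarLenPlusShape hE hC prop22i_holds (h c' hc'),
      theorem2_of_eStarLenPlusShape hE hC prop22i_holds (h c' hc')⟩⟩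

/-- **E-002 PRICED at level `C`, closed (the sentence a B-len DESIGN-MAP row prices):** for every sufficiently large
`c′`, `EStarLenPlusBounded c′ θ C 𝒱` + ONE design of the class whose robust margin holds at level `C` ⇒ Theorems 1
and 2 — no manuscript claim displayed (`theorem1_of_eStarLenPlusBounded`, p458017).
[cite: Zhang2022LandauSiegel, §1 Theorems 1–2; §2 p. 6, Lemma 2.3, Prop. 2.2 (i); §7 Prop 7.1 (7.2)] -/
theorem theorem1_of_eStarLenPlusBounded_closed :
    ∃ c₀ : ℝ, 0 ≤ c₀ ∧ ∀ c' : ℝ, c₀ ≤ c' → ∀ {θ C : ℝ} {𝒱 : (ℝ → ℂ) → (ℝ → ℂ) → Prop} {u u' v v' : ℝ → ℂ},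
      EStarLenPlusBounded c' θ C 𝒱 → InClassPiece u u' → 𝒱 v v' → RobustMargin θ C u u' v v' →
        Theorem1 ∧ Theorem2 := by
  obtain ⟨c₀, h0, h⟩ := lemma23_eventually
  exact ⟨c₀, h0, fun c' hc' _ _ _ _ _ _ _ hE hu hv hm =>
    ⟨theorem1_of_eStarLenPlusBounded hE hu hv hm prop22i_holds (h c' hc'),
      theorem2_of_eStarLenPlusBounded hE hu hv hm prop22i_holds (h c' hc')⟩⟩

end EStarLenPlusClosed

/-! ### Part 2 — E-070 / E-071 (`KnifeEdgeLambdaOverhang`): the Λ-overhang endgames, CLOSED -/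

section LambdaOverhangClosed

/-- **E-070/E-071 (the dictionary behind rows 25–26 and row 39), closed:** for every sufficiently large `c′`,
`ELambdaOverhang c′ θ K X Λs` + a closing Λ-overhang design ⇒ Theorems 1 and 2 (`theorem1_of_eLambdaOverhang`,
p461166, Part-I nodes discharged). [cite: Zhang2022LandauSiegel, §1 Theorems 1–2; §2 p. 6, Lemma 2.3, Prop. 2.2 (i); §7 Prop 7.1 (7.2)] -/
theorem theorem1_of_eLambdaOverhang_closed :
    ∃ c₀ : ℝ, 0 ≤ c₀ ∧ ∀ c' : ℝ, c₀ ≤ c' → ∀ {θ : ℝ} {K : LambdaDiag} {X : LambdaCross} {Λs : BandScale},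
      ELambdaOverhang c' θ K X Λs → ELambdaOverhangCloses θ K X → Theorem1 ∧ Theorem2 := by
  obtain ⟨c₀, h0, h⟩ := lemma23_eventually
  exact ⟨c₀, h0, fun c' hc' _ _ _ _ hE hC =>
    ⟨theorem1_of_eLambdaOverhang hE hC prop22i_holds (h c' hc'),
      theorem2_of_eLambdaOverhang hE hC prop22i_holds (h c' hc')⟩⟩

/-- **The edge-report route, closed:** for every sufficiently large `c′`, the dictionary at `c′` + ONE realised design
with `K > 0` whose derived block is INDEFINITE ⇒ Theorem 1 (`theorem1_of_eLambdaOverhang_indefinite`, p461166).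
[cite: Zhang2022LandauSiegel, §1 Theorem 1; §2 p. 6, Lemma 2.3, Prop. 2.2 (i); §7 Prop 7.1 (7.2)] -/
theorem theorem1_of_eLambdaOverhang_indefinite_closed :
    ∃ c₀ : ℝ, 0 ≤ c₀ ∧ ∀ c' : ℝ, c₀ ≤ c' → ∀ {θ : ℝ} {K : LambdaDiag} {X : LambdaCross} {Λs : BandScale}
      {u u' : ℝ → ℂ} {L : LambdaPiece} {v' : ℝ → ℂ},
      ELambdaOverhang c' θ K X Λs → KinkedProfile u u' → u 1 = 0 → L.Overhang θ v' → 0 < K L →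
        mainTermForm u u' * K L < ‖X u u' L‖ ^ 2 → Theorem1 := by
  obtain ⟨c₀, h0, h⟩ := lemma23_eventually
  exact ⟨c₀, h0, fun c' hc' _ _ _ _ _ _ _ _ hE hu hu1 hL hK hI =>
    theorem1_of_eLambdaOverhang_indefinite hE hu hu1 hL hK hI prop22i_holds (h c' hc')⟩

/-- **The positivity endgame for GRADED main terms, closed** (`eventually_not_assumptionA_of_le`, p462691 — the general
form behind the graded Λ rows): for every sufficiently large `c′`, a family of value tables whose discrete mean under
(A) is eventually `≤ M·𝔓 + ε𝔞𝔓` for every `ε > 0` with `M ≤ −η𝔞`, `η > 0`, refutes (A) for every real primitive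
character to every large modulus — no manuscript claim displayed.
[cite: Zhang2022LandauSiegel, §2 p. 6, Lemma 2.3, Prop. 2.2 (i), (2.15)] -/
theorem eventually_not_assumptionA_of_le_closed :
    ∃ c₀ : ℝ, 0 ≤ c₀ ∧ ∀ c' : ℝ, c₀ ≤ c' → ∀ {η : ℝ}, 0 < η →
      ∀ {F : ∀ (D : ℕ) [NeZero D] (χ : DirichletCharacter ℂ D), Chr D → ℂ → ℂ}
        {M : ∀ (D : ℕ) [NeZero D] (_ : DirichletCharacter ℂ D), ℝ},
      (∀ ε : ℝ, 0 < ε → ForAllLarge fun D _ χ => AssumptionA D χ →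
        discMean c' χ (F D χ) ≤ M D χ * frakP D + ε * frakA χ * frakP D) →
      (ForAllLarge fun D _ χ => AssumptionA D χ → M D χ ≤ -η * frakA χ) →
      ∃ D₀ : ℕ, ∀ (D : ℕ) [NeZero D] (χ : DirichletCharacter ℂ D),
        D₀ ≤ D → χ.IsQuadratic → χ.IsPrimitive → ¬ AssumptionA D χ := by
  obtain ⟨c₀, h0, h⟩ := lemma23_eventually
  exact ⟨c₀, h0, fun c' hc' _ hη _ _ hasymp hM =>
    eventually_not_assumptionA_of_le hη hasymp hM prop22i_holds (h c' hc')⟩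

/-- **The graded Λ-overhang endgame at a floor `a`, closed:** for every sufficiently large `c′`, the graded dictionary
at `c′` + ONE design closing at a floor `a` that (A) guarantees eventually ⇒ Theorem 1
(`theorem1_of_eLambdaOverhangGraded`, p462691, Part-I nodes discharged).
[cite: Zhang2022LandauSiegel, §1 Theorem 1; §2 p. 6, Lemma 2.3, Prop. 2.2 (i); §7 Prop 7.1 (7.2)] -/
theorem theorem1_of_eLambdaOverhangGraded_closed :
    ∃ c₀ : ℝ, 0 ≤ c₀ ∧ ∀ c' : ℝ, c₀ ≤ c' → ∀ {θ : ℝ} {K : LambdaDiag} {G : ℝ → LambdaCross} {a : ℝ}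
      {u u' : ℝ → ℂ} {L : LambdaPiece} {v' : ℝ → ℂ},
      ELambdaOverhangGraded c' θ K G → KinkedProfile u u' → u 1 = 0 → L.Overhang θ v' →
        LambdaGradedClosesAtFloor K G a u u' L →
        (ForAllLarge fun D _ χ => AssumptionA D χ → a ≤ frakA χ) → Theorem1 := by
  obtain ⟨c₀, h0, h⟩ := lemma23_eventually
  exact ⟨c₀, h0, fun c' hc' _ _ _ _ _ _ _ _ hE hu hu1 hL hC ha =>
    theorem1_of_eLambdaOverhangGraded hE hu hu1 hL hC ha prop22i_holds (h c' hc')⟩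

/-- **… at the tree's floor `a₀` (`frakA_floor`), closed:** for every sufficiently large `c′`, the graded dictionary at
`c′` + ONE design closing at the floor `aZero` ⇒ Theorems 1 AND 2 — no floor hypothesis, no manuscript claim displayed
(`theorem1_of_eLambdaOverhangGraded_aZero` / `theorem2_…`, p462691).
[cite: Zhang2022LandauSiegel, §1 Theorems 1–2; §2 p. 6, Lemma 2.3, Prop. 2.2 (i); §5 Lemma 5.7] -/
theorem theorem1_of_eLambdaOverhangGraded_aZero_closed :
    ∃ c₀ : ℝ, 0 ≤ c₀ ∧ ∀ c' : ℝ, c₀ ≤ c' → ∀ {θ : ℝ} {K : LambdaDiag} {G : ℝ → LambdaCross}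
      {u u' : ℝ → ℂ} {L : LambdaPiece} {v' : ℝ → ℂ},
      ELambdaOverhangGraded c' θ K G → KinkedProfile u u' → u 1 = 0 → L.Overhang θ v' →
        LambdaGradedClosesAtFloor K G aZero u u' L → Theorem1 ∧ Theorem2 := by
  obtain ⟨c₀, h0, h⟩ := lemma23_eventually
  exact ⟨c₀, h0, fun c' hc' _ _ _ _ _ _ _ hE hu hu1 hL hC =>
    ⟨theorem1_of_eLambdaOverhangGraded_aZero hE hu hu1 hL hC prop22i_holds (h c' hc'),
      theorem2_of_eLambdaOverhangGraded_aZero hE hu hu1 hL hC prop22i_holds (h c' hc')⟩⟩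

end LambdaOverhangClosed

end KnifeEdge

namespace Repair

open KnifeEdge Skeleton

/-! ### Part 3 — E-17 (`RepairBlenMuNu`): the νψ family verdict and its (c)-door, CLOSED -/

section NuClosed

/-- **E-17 per world, closed:** for every sufficiently large `c′` and every scale `S`, every member `d` of (L-b)∣νψ
satisfies the family verdict of `familyNuOverhang c′ S` with the manuscript's `Prop22i` / `Lemma23 c′` binders
DISCHARGED: GIVEN the displayed slot `NuMeanInvisible c′ θ (bvOverhang θ) S` (E-074′) and `ScaleEventuallyPos S`,
(i) the dictionary of record is `(M, X) = (0, 0)` and (ii) the member is lever-free (`HasMainConstant` preserved for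
every `m ≥ 0`). Composition of `familyNuOverhang_decided` (p469249) with `prop22i_holds` / `lemma23_eventually`.
[cite: Zhang2022LandauSiegel, §2 (2.16), Lemma 2.3, Prop. 2.2 (i); §4 Lemma 4.2, (4.10)] -/
theorem familyNuOverhang_verdict_closed :
    ∃ c₀ : ℝ, 0 ≤ c₀ ∧ ∀ c' : ℝ, c₀ ≤ c' → ∀ (S : Scale) (d : NuDesign), d.InClass →
      NuMeanInvisible c' d.θ (bvOverhang d.θ) S → ScaleEventuallyPos S →
        NuDict c' d.θ (bvOverhang d.θ) S (fun _ _ => 0) 0 ∧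
          ∀ m : ℝ, 0 ≤ m → ∀ F : (D : ℕ) → [NeZero D] → DirichletCharacter ℂ D → Chr D → ℂ → ℂ,
            HasMainConstant c' S F m → HasMainConstant c' S (d.extend F) m := by
  obtain ⟨c₀, h0, h⟩ := lemma23_eventually
  exact ⟨c₀, h0, fun c' hc' S d hd hInv hS =>
    familyNuOverhang_decided c' S d hd hInv hS prop22i_holds (h c' hc')⟩

/-- **E-17, the CLOSED family `familyNuOverhangAll`, closed in `c′`:** for every member `d` and every world `(c′, S)`
with `c′ ≥ c₀`, the verdict conjuncts hold given only the slot and `ScaleEventuallyPos S` — the residual displayed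
inputs of row E-17 after the Part-I discharge. [cite: Zhang2022LandauSiegel, §2 (2.16), Lemma 2.3, Prop. 2.2 (i); §4 Lemma 4.2] -/
theorem familyNuOverhangAll_verdict_closed :
    ∃ c₀ : ℝ, 0 ≤ c₀ ∧ ∀ (d : NuDesign), familyNuOverhangAll.InClass d → ∀ (c' : ℝ) (S : Scale), c₀ ≤ c' →
      NuMeanInvisible c' d.θ (bvOverhang d.θ) S → ScaleEventuallyPos S →
        NuDict c' d.θ (bvOverhang d.θ) S (fun _ _ => 0) 0 ∧
          ∀ m : ℝ, 0 ≤ m → ∀ F : (D : ℕ) → [NeZero D] → DirichletCharacter ℂ D → Chr D → ℂ → ℂ,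
            HasMainConstant c' S F m → HasMainConstant c' S (d.extend F) m := by
  obtain ⟨c₀, h0, h⟩ := familyNuOverhang_verdict_closed
  exact ⟨c₀, h0, fun d hd c' S hc' hInv hS => h c' hc' S d hd hInv hS⟩

/-- **The verdict unbundled, closed** (`not_repairable_nuOverhang`, p469249, Part-I nodes discharged): for every
sufficiently large `c′`, a bounded-variation νψ-overhang at top `θ > 1`, GIVEN the slot and an eventually positive scale,
leaves every main constant `m ≥ 0` unchanged. [cite: Zhang2022LandauSiegel, §2 (2.16), Lemma 2.3, Prop. 2.2 (i); §4 Lemma 4.2] -/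
theorem not_repairable_nuOverhang_closed :
    ∃ c₀ : ℝ, 0 ≤ c₀ ∧ ∀ c' : ℝ, c₀ ≤ c' → ∀ {S : Scale} {θ : ℝ} {v v' : ℝ → ℂ}, 1 < θ → bvOverhang θ v v' →
      NuMeanInvisible c' θ (bvOverhang θ) S → ScaleEventuallyPos S → ∀ {m : ℝ}, 0 ≤ m →
        ∀ {F : (D : ℕ) → [NeZero D] → DirichletCharacter ℂ D → Chr D → ℂ → ℂ},
          HasMainConstant c' S F m → HasMainConstant c' S ((⟨θ, v, v'⟩ : NuDesign).extend F) m := by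
  obtain ⟨c₀, h0, h⟩ := lemma23_eventually
  exact ⟨c₀, h0, fun c' hc' _ _ _ _ hθ hv hInv hS _ hm _ hF =>
    not_repairable_nuOverhang hθ hv hInv hS prop22i_holds (h c' hc') hm hF⟩

/-- **The X-world reading, closed** (`familyNuOverhangAll_record_not_closes`, p469249): for every sufficiently large
`c′`, GIVEN the slot, the dictionary of record `(0, 0)` IS the ν dictionary at `c′` and never closes — no manuscript
claim displayed. [cite: Zhang2022LandauSiegel, §2 (2.16), Lemma 2.3, Prop. 2.2 (i); §4 Lemma 4.2] -/
theorem familyNuOverhangAll_record_not_closes_closed :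
    ∃ c₀ : ℝ, 0 ≤ c₀ ∧ ∀ c' : ℝ, c₀ ≤ c' → ∀ {S : Scale} {θ : ℝ},
      NuMeanInvisible c' θ (bvOverhang θ) S →
        NuDict c' θ (bvOverhang θ) S (fun _ _ => 0) 0 ∧ ¬ NuCloses (bvOverhang θ) (fun _ _ => 0) 0 := by
  obtain ⟨c₀, h0, h⟩ := lemma23_eventually
  exact ⟨c₀, h0, fun c' hc' _ _ hInv => familyNuOverhangAll_record_not_closes hInv prop22i_holds (h c' hc')⟩

/-- **The (c)-door of the νψ row, closed** (`theorem1_of_negative_mainConstant`, p469249): for every sufficiently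
large `c′`, a design polynomial family with a NEGATIVE main constant at an eventually positive scale already gives
Theorem 1 of the manuscript — no manuscript claim displayed. [cite: Zhang2022LandauSiegel, §1 Theorem 1; §2 p. 6, (2.16), Lemma 2.3, Prop. 2.2 (i)] -/
theorem theorem1_of_negative_mainConstant_closed :
    ∃ c₀ : ℝ, 0 ≤ c₀ ∧ ∀ c' : ℝ, c₀ ≤ c' → ∀ {S : Scale} {m : ℝ}, m < 0 → ScaleEventuallyPos S →
      ∀ {F : (D : ℕ) → [NeZero D] → DirichletCharacter ℂ D → Chr D → ℂ → ℂ},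
        HasMainConstant c' S F m → Theorem1 := by
  obtain ⟨c₀, h0, h⟩ := lemma23_eventually
  exact ⟨c₀, h0, fun c' hc' _ _ hm hS _ hF =>
    theorem1_of_negative_mainConstant hm hS hF prop22i_holds (h c' hc')⟩

end NuClosed

end Repair

end Literature.NumberTheory.LFunctions.Zhang2022

end
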